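import Summits.QuantumFields.BalabanUV.Beta.GAN24.CombSlotDerivativeBorderRead
import Summits.QuantumFields.BalabanUV.Beta.GAN24.ContactFaceJump
import Summits.QuantumFields.BalabanUV.Beta.GAN24.ContactLambdaCommutator
import Summits.QuantumFields.BalabanUV.Beta.RelInvBorderedHessian
import Summits.QuantumFields.BalabanUV.Beta.GAN24.ExitDefectContourSums

/-!
# `BalabanUV.Beta.GAN24.BorderGaugeLegBlockPotential` — binder row G-an2-4 ∕ (CONV-C), the (S) row ∕ (W-γ) of RULING R-gan24p1-g27-1 B (viii), supplier side:
# **THE V-LAW — an1's ROOTED BORDER TABLE `vhSAt ρ` AGAINST A BLOCK PURE GAUGE `dz(ψ ∘ blk)` IN ITS FLUCTUATION SLOT RETURNS MINUS THE FACE JUMP `(dzψ)_μ(w)` AT THE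
# MULTIPLIER LEG's COARSE BOND TIMES THE ROOTED ONE-STEP KERNEL `q¹,ρ_{(μ,w)}` RESTRICTED TO BACKGROUND BONDS WHOSE TIP LIES IN THE BLOCK `w`; at road-P2's slot derivative
# `dM K Lc S_j M1_j ν y′` (ANY kernel `K`, every level `j`) the `(inr μ, inl κ₂)` block against `dz(ψ∘blk)` is `−(cVH·wVH_j)·(dzψ)_μ(w)·(Lc^{d+1})⁻¹·(END-INSIDE partial contour
# reading of the `ℋ`-column + its block-`w` comb reading)`, the comb reading absent for every `Π_bm`-co-dressed `G`**
# (G-an2-4 formalisation swarm → CRUX TEAM (2), seat `b2b-balaban-gan24-formalise-leaf-02`, gen 60; INTENT [LEAF02-G60-INTENT1]; answers leaf-06 g49's R1 [GAN24LEAF06-G49-R1]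
# «the V-law is a second-slot law of an1's `vhSAt` with a block-constant gauge leg — if either of you has it typed or half-typed, say so»)

NOT IN PRINT; OUR BOOKKEEPING ([folklore] packaging BY NAME: this seat's g47 `BorderGaugeLegContact.tsum_vhSAt_mul_dz ∕ tsum_dz_mul_vhSAt ∕ vhSAt_inr_inl_eq_zero_of_not_mem` (the
fluctuation-slot `dψ`-law for EVERY `ψ`), leaf-01 g60 `ContactFaceJump.linKerAt_eq_zero_of_not_twoBlock ∕ blk_farRoot ∕ bonds_axial ∕ blk_eq_of_hull_block` (the two-block support of
`q¹,ρ`; both endpoints of the axial bonds in the hull), road-P2 g40 `CombSlotDerivativeBorderRead.dM_inr_inl` (the block of the slot derivative is the `ℋ`-column-weighted border),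
this seat's g48 `ContactLambdaCommutator.tsum_sum_linKerAt_mul` (the `q¹`-pairing of a form is its rooted average), an1's `AveragingContoursRooted.linAvgAt_eq_contourSum_sub_dz`,
an2's `BorderedHessian.isCombBondAt_of_mem_axial`, `AxialDressingRooted.colH_coDressKBmAt ∕ pmBm_eq_zero_of_isCombBond`, an2-g30 ∕ this seat's `LinearGaugeVH.vhSAt_eq_zero_of_not_mem`;
0 `def`, 0 cited fact, 0 `def … : Prop`, 0 sorry; every sum in §2 is FINITE — no decay of `K`, no bound on `ψ`).
HONEST FRAMING (cell contract, verbatim): «discharging `BetaPertH` makes Bałaban's UV stability UNCONDITIONAL — a real constructive-QFT result; it is NOT the continuum limit and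
NOT the Clay problem.»  HONEST DEPENDENCY (verbatim): «continuum YM on T⁴ ⇐ BetaPertH ∧ nine spine estimates (0/9 proved); BetaPertH ⇐ (D1) ∧ (D4) ∧ CAP+tail; G-an2-4 gates
asym, D1 and NE2/3/4.»

WHY.  leaf-06 g49's ENGINE E30∕E31 (`HOME/b2b-balaban-gan24-formalise-leaf-06/g49/E30-E31-CENSUS.md`, float64, D = 2 and 3): the closed form of the (W-γ) source pairing `X_1` one
level up (road-P2 g43 (5.2)'s `hX`) rests on three SECTOR LAWS of the level-0 table read against two-level legs, of which the border sector is
«V = −n^{−2D}·⟨dψ ⊙ Qei H_0 h, C_0 n⟩ — a second-slot law of an1's `vhSAt` with a block-constant pure-gauge fluctuation leg», listed as input (vi) «to type».  Half of it was in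
the tree (g47: the `dψ`-law for every `ψ`, bracket `Ψ(u′+e_κ′) − Ψ(p + ρ + Lc·e_μ)`; p2 g40 carried it to the slot derivative at `Ψ = 1_{B(y)}`).  This file is the other half:
for `Ψ = ψ ∘ blk` the bracket COLLAPSES on the two-block support of `q¹,ρ` (§1), the slot-derivative form follows for ANY kernel by finite-support bookkeeping (§2), and the
tip-inside reading of `q¹,ρ` against any form `B` is `(Lc^{d+1})⁻¹·(contourSum Lc B^{tip}_w + LamAt ρ B Lc w)` (§3): leaf-06's END-INSIDE `Qei` (weight `i+1` on the `μ`-bonds of the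
block at offset `i ≤ Lc−2`) plus the block's comb reading, absent for comb-free `B` — e.g. the field rows of every co-dressed `G_j` (§4).

WHAT (generic `d`; box root `ρ = toSite r`, `r ∈ box (d+1) L`; `B^{tip}_w κ u := 𝟙[blk L (u + e_κ) = w]·B κ u` written inline).
* §1 `blockBracket_mul_linKerAt`; **`tsum_vhSAt_mul_dz_blockPot`** (`(inr μ, inl α)` block: `Σ'_x Σ_α vhSAt ρ κ′ u′ p x (inr μ)(inl α)·dz(ψ∘blk) α x
  = −(dzψ)_μ(blk p)·𝟙[blk(u′+e_κ′) = blk p]·linSymAt ρ L p u′ (inr μ)(inl κ′)`), **`tsum_dz_mul_vhSAt_blockPot`** (the `(inl, inr)` twin).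
* §2 **`tsum_dM_inr_inl_mul_dz_blockPot`** — ANY `K`, every `j`, all `cE cVH cΛ`: `Σ'_x Σ_κ₂ dM K Lc S_j M1_j ν y′ p x (inr μ)(inl κ₂)·dz(ψ∘blk) κ₂ x
  = −(cVH·wVH_j)·(dzψ)_μ(blk p)·Σ_κ′ Σ'_u′ 𝟙[blk(u′+e_κ′) = blk p]·colH K Lc ν y′ κ′ u′·linSymAt ρ Lc p u′ (inr μ)(inl κ′)` (the shape of road-P2 g43's displayed `hP`).
* §3 `LamAt_tipInside_of_ne`, `LamAt_tipInside_self`, **`LamAt_eq_zero_of_combFree`**, **`tsum_sum_linKerAt_mul_tipInside`** ∕ `sum_tsum_tipInside_mul_linKerAt`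
  (`Σ'_u Σ_κ q¹,ρ_{(μ,w)}(κ,u)·B^{tip}_w κ u = (L^{d+1})⁻¹·(contourSum L B^{tip}_w μ w + LamAt ρ B L w)`, EVERY real `B`), `contourSum_tipInside_eq_endInside` (= leaf-06's `EI_L`).
* §4 **`tsum_dM_inr_inl_zsmul_mul_dz_blockPot`** (`p = Lc•w`: `… = −(cVH·wVH_j)·(dzψ)_μ(w)·(Lc^{d+1})⁻¹·(contourSum Lc H^{tip}_w μ w + LamAt ρ H Lc w)`,
  `H = colH K Lc ν y′`), `…_of_combFree`, `colH_coDressKBmAt_eq_zero_of_isCombBond`, **`tsum_dM_coDressKBmAt_inr_inl_zsmul_mul_dz_blockPot`** (`K ↦ coDressKBmAt ρ Lc K`: NO axial term).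
Asserts NO value of any resolvent column; NOTHING of (W-γ)_{k≥1} ∕ (S) above level 0 ∕ (C1′) ∕ (C2′) ∕ (INV) ∕ (Q-R) ∕ (DL) ∕ (LT) ∕ (Q-L) ∕ (C) ∕ «T2Shape» ∕ (hW, hWall) discharged;
NEVER «G-an2-4 closed» as (CONV-C); NOT D1, NOT `BetaPertH`, NOT continuum, NOT Clay.  2026-08-23; no existing file touched.
-/

noncomputable section

open Finset
open Literature.MathematicalPhysics.QuantumFieldTheory
open Literature.MathematicalPhysics.QuantumFieldTheory.Balaban1983to89
open Literature.MathematicalPhysics.QuantumFieldTheory.Balaban1983to89.Beta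
open ExpKernelCalculus (Site MKer)
open AffineAveraging (Form0 Form1 box toSite unitVec unitVec_apply dz contourSum)
open AveragingContours (blk off)
open AveragingContours (axial axial_sum_sub)
open AveragingContoursRooted (LamAt linAvgAt_eq_contourSum_sub_dz)
open AveragingHessianKernels (Bond Near Hull eq_smul_blk_of_off_eq_zero)
open AxialProjector (blk_zsmul)
open RootedKernelReflection (off_zsmul)
open AveragingHessianKernelsRooted (vhSAt linKerAt linKerAt_eq_zero)
open OneStepResolventKernel (Fib)
open OneStepKernelFamily (colH)
open SecondOrderResponse (dM)
open BalabanStepJetsSucc (wVH)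
open Summit.QuantumFields.BalabanUV.Beta.SpineRooted (SpureRecAt M1At)
open Summit.QuantumFields.BalabanUV.Beta.AveragingWardRootedStencils (linSymAt linSymAt_inl_inr linSymAt_inr_inl)
open Summit.QuantumFields.BalabanUV.Beta.LinearGaugeVH (nearBox mem_nearBox)
open Summit.QuantumFields.BalabanUV.Beta.GAN24.BorderGaugeLegContact (tsum_vhSAt_mul_dz tsum_dz_mul_vhSAt vhSAt_inr_inl_eq_zero_of_not_mem)
open Summit.QuantumFields.BalabanUV.Beta.GAN24.ContactFaceJump (linKerAt_eq_zero_of_not_twoBlock blk_farRoot bonds_axial blk_eq_of_hull_block)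
open Summit.QuantumFields.BalabanUV.Beta.GAN24.ContactLambdaCommutator (tsum_sum_linKerAt_mul linKerAt_eq_zero_of_not_mem)
open Summit.QuantumFields.BalabanUV.Beta.AxialDressingRooted (IsCombBondAt coDressKBmAt colH_coDressKBmAt pmBm_eq_zero_of_isCombBond)
open Summit.QuantumFields.BalabanUV.Beta.BorderedHessian (isCombBondAt_of_mem_axial)
open Summit.QuantumFields.BalabanUV.Beta.GAN24.CombSlotDerivativeBorderRead (dM_inr_inl)
open Summit.QuantumFields.BalabanUV.Beta.GAN24.ExitDefectContourSums (blk_contourPoint)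

namespace Summit.QuantumFields.BalabanUV.Beta.GAN24.BorderGaugeLegBlockPotential

variable {d : ℕ}

/-! ## §1 The bracket of the border `dψ`-law collapses for block-constant gauge functions -/

/-- [folklore] `w + e_μ ≠ w`. -/
theorem add_unitVec_ne (w : Site (d + 1)) (μ : Fin (d + 1)) : w + unitVec μ ≠ w := fun e => by
  have e' := congrFun e μ; simp only [Pi.add_apply, unitVec_apply, if_true] at e'; linarith

/-- NOT IN PRINT; OUR BOOKKEEPING.  **ON THE TWO-BLOCK SUPPORT OF THE ROOTED ONE-STEP KERNEL THE BLOCK-CONSTANT BRACKET IS MINUS THE FACE JUMP TIMES THE TIP-INSIDE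
INDICATOR** (box root, `1 ≤ L`, coarse bond `(μ, w)`, background bond `(κ′, u′)`, any coarse `ψ`):
`(ψ(blk L (u′ + e_κ′)) − ψ(w + e_μ))·q¹,ρ_{(μ,w)}(κ′,u′) = −(dz ψ)_μ(w)·𝟙[blk L (u′ + e_κ′) = w]·q¹,ρ_{(μ,w)}(κ′,u′)` — leaf-01's `linKerAt_eq_zero_of_not_twoBlock`: where `q¹,ρ ≠ 0`
the tip of the background bond has block label `w` (bracket `ψ w − ψ(w+e_μ)`) or `w + e_μ` (bracket `0`). -/
theorem blockBracket_mul_linKerAt {L : ℕ} (hL : 1 ≤ L) {r : Fin (d + 1) → ℕ} (hr : r ∈ box (d + 1) L) (ψ : Site (d + 1) → ℝ)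
    (μ : Fin (d + 1)) (w : Site (d + 1)) (κ' : Fin (d + 1)) (u' : Site (d + 1)) :
    (ψ (blk L (u' + unitVec κ')) - ψ (w + unitVec μ)) * linKerAt (toSite r) L μ w (κ', u')
      = -(dz ψ μ w) * (if blk L (u' + unitVec κ') = w then (1 : ℝ) else 0) * linKerAt (toSite r) L μ w (κ', u') := by
  by_cases hq : linKerAt (toSite r) L μ w (κ', u') = 0
  · rw [hq, mul_zero, mul_zero]
  · have hsupp : (blk L u' = w ∨ blk L u' = w + unitVec μ) ∧
        (blk L (u' + unitVec κ') = w ∨ blk L (u' + unitVec κ') = w + unitVec μ) := by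
      by_contra h
      exact hq (linKerAt_eq_zero_of_not_twoBlock hL hr (f := (κ', u')) h)
    rcases hsupp.2 with h | h
    · rw [h, if_pos rfl, dz]; ring
    · have hne : blk L (u' + unitVec κ') ≠ w := by rw [h]; exact add_unitVec_ne w μ
      rw [if_neg hne, h, sub_self, zero_mul, mul_zero, zero_mul]

/-- NOT IN PRINT; OUR BOOKKEEPING.  **THE BORDER TABLE AGAINST A BLOCK PURE GAUGE, `(inr μ, inl α)` BLOCK (multiplier leg at the first site `p`, fluctuation at the second)**:
for `Ψ = ψ ∘ blk L` (ANY coarse `ψ`), box root, every background bond `(κ′,u′)`,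
`Σ'_x Σ_α vhSAt ρ κ′ u′ p x (inr μ)(inl α)·(dz Ψ)_α(x) = −(dz ψ)_μ(blk L p)·𝟙[blk L (u′ + e_κ′) = blk L p]·linSymAt ρ L p u′ (inr μ)(inl κ′)`
— g47 `tsum_vhSAt_mul_dz` (bracket `Ψ(u′+e_κ′) − Ψ(p + ρ + L·e_μ)`), leaf-01's `blk_farRoot`, and the collapse above.  «The border table against a block pure gauge returns the
rooted one-step kernel of the multiplier leg's coarse bond, restricted to background bonds whose TIP lies in that bond's near block, times minus the face jump.» -/
theorem tsum_vhSAt_mul_dz_blockPot {L : ℕ} (hL : 1 ≤ L) {r : Fin (d + 1) → ℕ} (hr : r ∈ box (d + 1) L) (κ' : Fin (d + 1)) (u' p : Site (d + 1))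
    (μ : Fin (d + 1)) {Ψ : Site (d + 1) → ℝ} (ψ : Site (d + 1) → ℝ) (hΨ : ∀ x, Ψ x = ψ (blk L x)) :
    ∑' x, ∑ α, vhSAt (toSite r) d L rfl κ' u' p x (Sum.inr μ) (Sum.inl α) * dz Ψ α x
      = -(dz ψ μ (blk L p)) * (if blk L (u' + unitVec κ') = blk L p then (1 : ℝ) else 0)
          * linSymAt (toSite r) L p u' (Sum.inr μ) (Sum.inl κ') := by
  rw [tsum_vhSAt_mul_dz hL hr κ' u' p μ Ψ, linSymAt_inr_inl]
  by_cases hoff : off L p = 0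
  · simp only [hoff, if_true]
    have hp : p + toSite r + (L : ℤ) • unitVec μ = (L : ℤ) • blk L p + toSite r + (L : ℤ) • unitVec μ := by
      rw [← eq_smul_blk_of_off_eq_zero hL hoff]
    rw [hΨ, hΨ, hp, blk_farRoot (blk L p) μ hr]
    exact blockBracket_mul_linKerAt hL hr ψ μ (blk L p) κ' u'
  · simp only [hoff, if_false, mul_zero]

/-- NOT IN PRINT; OUR BOOKKEEPING.  **THE `(inl α, inr μ)` BLOCK** (fluctuation at the first site `x`, multiplier leg at the second site `p`):
`Σ'_x Σ_α (dz Ψ)_α(x)·vhSAt ρ κ′ u′ x p (inl α)(inr μ) = −(dz ψ)_μ(blk L p)·𝟙[blk L (u′ + e_κ′) = blk L p]·linSymAt ρ L u′ p (inl κ′)(inr μ)` (g47 `tsum_dz_mul_vhSAt`). -/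
theorem tsum_dz_mul_vhSAt_blockPot {L : ℕ} (hL : 1 ≤ L) {r : Fin (d + 1) → ℕ} (hr : r ∈ box (d + 1) L) (κ' : Fin (d + 1)) (u' p : Site (d + 1))
    (μ : Fin (d + 1)) {Ψ : Site (d + 1) → ℝ} (ψ : Site (d + 1) → ℝ) (hΨ : ∀ x, Ψ x = ψ (blk L x)) :
    ∑' x, ∑ α, dz Ψ α x * vhSAt (toSite r) d L rfl κ' u' x p (Sum.inl α) (Sum.inr μ)
      = -(dz ψ μ (blk L p)) * (if blk L (u' + unitVec κ') = blk L p then (1 : ℝ) else 0)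
          * linSymAt (toSite r) L u' p (Sum.inl κ') (Sum.inr μ) := by
  rw [tsum_dz_mul_vhSAt hL hr κ' u' p μ Ψ, linSymAt_inl_inr]
  by_cases hoff : off L p = 0
  · simp only [hoff, if_true]
    have hp : p + toSite r + (L : ℤ) • unitVec μ = (L : ℤ) • blk L p + toSite r + (L : ℤ) • unitVec μ := by
      rw [← eq_smul_blk_of_off_eq_zero hL hoff]
    rw [hΨ, hΨ, hp, blk_farRoot (blk L p) μ hr]
    exact blockBracket_mul_linKerAt hL hr ψ μ (blk L p) κ' u'
  · simp only [hoff, if_false, mul_zero]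

/-! ## §2 The slot derivative: the multiplier-row ∕ field-column block of `dM K Lc S_j M1_j ν y′` against a block pure gauge — ANY kernel `K`, all sums finite -/

section SlotDerivative

variable {Lc : ℕ} [NeZero Lc]

/-- NOT IN PRINT; OUR BOOKKEEPING.  **THE V-LAW AT THE SLOT DERIVATIVE (road-P2's currency), FOR EVERY KERNEL `K` AND EVERY BLOCK-CONSTANT `Ψ = ψ ∘ blk Lc`** (box root
`ρ = toSite r`, every level `j`, all `cE cVH cΛ`, slot `(ν, y′)`, multiplier leg `(μ, p)`):
`Σ'_x Σ_κ₂ (dM K Lc S_j M1_j ν y′) p x (inr μ)(inl κ₂)·(dz Ψ)_κ₂(x)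
   = −(cVH·wVH d Lc j)·(dz ψ)_μ(blk Lc p)·Σ_κ′ Σ'_u′ 𝟙[blk Lc (u′ + e_κ′) = blk Lc p]·colH K Lc ν y′ κ′ u′·linSymAt ρ Lc p u′ (inr μ)(inl κ′)`
— p2 g40's `dM_inr_inl` then §1 termwise.  NO decay of `K`, NO bound on `ψ`: for fixed `p` the border entries vanish unless `x ∈ nearBox (blk p)` (g47
`vhSAt_inr_inl_eq_zero_of_not_mem`) and `u′ ∈ nearBox (blk p) ∪ nearBox (blk x)` (`LinearGaugeVH.vhSAt_eq_zero_of_not_mem`), so every sum is finite and Fubini is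
`Finset.sum_comm`.  The right-hand side has the shape of road-P2 g43's displayed `hP` (`𝟙[blk(u+e_κ) = y]·colH G(e) κ u·…`). -/
theorem tsum_dM_inr_inl_mul_dz_blockPot (K : MKer (d + 1) (Fib d)) (hLc : 1 ≤ Lc) {r : Fin (d + 1) → ℕ} (hr : r ∈ box (d + 1) Lc)
    (cE cVH cΛ : ℝ) (j : ℕ) (ν : Fin (d + 1)) (y' p : Site (d + 1)) (μ : Fin (d + 1)) {Ψ : Site (d + 1) → ℝ} (ψ : Site (d + 1) → ℝ)
    (hΨ : ∀ x, Ψ x = ψ (blk Lc x)) :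
    ∑' x, ∑ κ₂, dM K Lc (SpureRecAt d Lc (toSite r) cE cVH cΛ j) (M1At d Lc (toSite r) cΛ j) ν y' p x (Sum.inr μ) (Sum.inl κ₂) * dz Ψ κ₂ x
      = -(cVH * wVH d Lc j) * dz ψ μ (blk Lc p)
          * ∑ κ', ∑' u', (if blk Lc (u' + unitVec κ') = blk Lc p then (1 : ℝ) else 0) * colH K Lc ν y' κ' u'
              * linSymAt (toSite r) Lc p u' (Sum.inr μ) (Sum.inl κ') := by
  set V : Fin (d + 1) → Site (d + 1) → Site (d + 1) → Fin (d + 1) → ℝ :=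
    fun κ' u' x κ₂ => vhSAt (toSite r) d Lc rfl κ' u' p x (Sum.inr μ) (Sum.inl κ₂) with hV
  set Sx : Finset (Site (d + 1)) := nearBox Lc (blk Lc p) with hSx
  have hVx : ∀ κ' u' κ₂ x, x ∉ Sx → V κ' u' x κ₂ = 0 := fun κ' u' κ₂ x hx =>
    vhSAt_inr_inl_eq_zero_of_not_mem hr κ' u' p μ κ₂ hx
  set Su : Finset (Site (d + 1)) := nearBox Lc (blk Lc p) ∪ Sx.biUnion (fun x => nearBox Lc (blk Lc x)) with hSu
  have hVu : ∀ κ' κ₂ x, x ∈ Sx → ∀ u', u' ∉ Su → V κ' u' x κ₂ = 0 := by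
    intro κ' κ₂ x hx u' hu'
    refine LinearGaugeVH.vhSAt_eq_zero_of_not_mem hr κ' p x (Sum.inr μ) (Sum.inl κ₂) ?_
    intro hmem
    rw [Finset.mem_union] at hmem
    exact hu' (Finset.mem_union.2 (hmem.elim (fun h1 => Or.inr (Finset.mem_biUnion.2 ⟨x, hx, h1⟩)) Or.inl))
  have hQu : ∀ κ' u', u' ∉ Su → linSymAt (toSite r) Lc p u' (Sum.inr μ) (Sum.inl κ') = 0 := by
    intro κ' u' hu'
    have hu'' : u' ∉ nearBox Lc (blk Lc p) := fun h => hu' (Finset.mem_union.2 (Or.inl h))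
    rw [linSymAt_inr_inl]
    split_ifs
    · exact linKerAt_eq_zero hr (f := (κ', u')) (by rwa [mem_nearBox] at hu'')
    · rfl
  -- Step A: p2's block reduction termwise; the `x`-sum is finite; Step B: so is the `u'`-sum; Step C: §1 per background bond; Steps D∕E: finite rearrangement
  have eA : ∀ x, ∑ κ₂, dM K Lc (SpureRecAt d Lc (toSite r) cE cVH cΛ j) (M1At d Lc (toSite r) cΛ j) ν y' p x (Sum.inr μ) (Sum.inl κ₂) * dz Ψ κ₂ x
      = ∑ κ₂, ((cVH * wVH d Lc j) * ∑ κ', ∑' u', colH K Lc ν y' κ' u' * V κ' u' x κ₂) * dz Ψ κ₂ x := fun x =>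
    Finset.sum_congr rfl fun κ₂ _ => by rw [dM_inr_inl]
  have hxsupp : ∀ x ∉ Sx, ∑ κ₂, ((cVH * wVH d Lc j) * ∑ κ', ∑' u', colH K Lc ν y' κ' u' * V κ' u' x κ₂) * dz Ψ κ₂ x = 0 := by
    intro x hx
    refine Finset.sum_eq_zero fun κ₂ _ => ?_
    have h0 : ∀ κ', ∑' u', colH K Lc ν y' κ' u' * V κ' u' x κ₂ = 0 := fun κ' => by
      rw [show (fun u' => colH K Lc ν y' κ' u' * V κ' u' x κ₂) = fun _ => 0 from funext fun u' => by rw [hVx κ' u' κ₂ x hx, mul_zero]]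
      exact tsum_zero
    simp only [h0, Finset.sum_const_zero, mul_zero, zero_mul]
  rw [tsum_congr eA, tsum_eq_sum (s := Sx) hxsupp]
  have eB : ∀ x ∈ Sx, ∑ κ₂, ((cVH * wVH d Lc j) * ∑ κ', ∑' u', colH K Lc ν y' κ' u' * V κ' u' x κ₂) * dz Ψ κ₂ x
      = ∑ κ₂, ((cVH * wVH d Lc j) * ∑ κ', ∑ u' ∈ Su, colH K Lc ν y' κ' u' * V κ' u' x κ₂) * dz Ψ κ₂ x := by
    intro x hx
    refine Finset.sum_congr rfl fun κ₂ _ => ?_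
    congr 2
    refine Finset.sum_congr rfl fun κ' _ => tsum_eq_sum (s := Su) fun u' hu' => ?_
    rw [hVu κ' κ₂ x hx u' hu', mul_zero]
  rw [Finset.sum_congr rfl eB]
  have eC : ∀ κ' u', ∑ x ∈ Sx, ∑ κ₂, V κ' u' x κ₂ * dz Ψ κ₂ x
      = -(dz ψ μ (blk Lc p)) * (if blk Lc (u' + unitVec κ') = blk Lc p then (1 : ℝ) else 0)
          * linSymAt (toSite r) Lc p u' (Sum.inr μ) (Sum.inl κ') := by
    intro κ' u'
    have h := tsum_vhSAt_mul_dz_blockPot hLc hr κ' u' p μ ψ hΨ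
    rw [tsum_eq_sum (s := Sx) (fun x hx => Finset.sum_eq_zero fun κ₂ _ => by
      show V κ' u' x κ₂ * dz Ψ κ₂ x = 0
      rw [hVx κ' u' κ₂ x hx, zero_mul])] at h
    exact h
  have eD : ∑ x ∈ Sx, ∑ κ₂, ((cVH * wVH d Lc j) * ∑ κ', ∑ u' ∈ Su, colH K Lc ν y' κ' u' * V κ' u' x κ₂) * dz Ψ κ₂ x
      = (cVH * wVH d Lc j) * ∑ κ', ∑ u' ∈ Su, colH K Lc ν y' κ' u' * (∑ x ∈ Sx, ∑ κ₂, V κ' u' x κ₂ * dz Ψ κ₂ x) := by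
    have e1 : ∀ x ∈ Sx, ∑ κ₂, ((cVH * wVH d Lc j) * ∑ κ', ∑ u' ∈ Su, colH K Lc ν y' κ' u' * V κ' u' x κ₂) * dz Ψ κ₂ x
        = (cVH * wVH d Lc j) * ∑ κ', ∑ u' ∈ Su, colH K Lc ν y' κ' u' * (∑ κ₂, V κ' u' x κ₂ * dz Ψ κ₂ x) := by
      intro x _
      simp only [Finset.mul_sum, Finset.sum_mul]
      rw [Finset.sum_comm]
      refine Finset.sum_congr rfl fun κ' _ => ?_
      rw [Finset.sum_comm]
      exact Finset.sum_congr rfl fun u' _ => Finset.sum_congr rfl fun κ₂ _ => by ring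
    rw [Finset.sum_congr rfl e1, ← Finset.mul_sum]
    congr 1
    rw [Finset.sum_comm]
    refine Finset.sum_congr rfl fun κ' _ => ?_
    rw [Finset.sum_comm]
    refine Finset.sum_congr rfl fun u' _ => ?_
    rw [Finset.mul_sum]
  rw [eD]
  simp only [eC]
  have eE : ∀ κ', ∑ u' ∈ Su, colH K Lc ν y' κ' u' * (-(dz ψ μ (blk Lc p)) * (if blk Lc (u' + unitVec κ') = blk Lc p then (1 : ℝ) else 0)
        * linSymAt (toSite r) Lc p u' (Sum.inr μ) (Sum.inl κ'))
      = -(dz ψ μ (blk Lc p)) * ∑' u', (if blk Lc (u' + unitVec κ') = blk Lc p then (1 : ℝ) else 0) * colH K Lc ν y' κ' u'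
          * linSymAt (toSite r) Lc p u' (Sum.inr μ) (Sum.inl κ') := by
    intro κ'
    rw [tsum_eq_sum (s := Su) (fun u' hu' => by rw [hQu κ' u' hu', mul_zero]), Finset.mul_sum]
    exact Finset.sum_congr rfl fun u' _ => by ring
  simp only [eE, ← Finset.mul_sum]
  ring

end SlotDerivative

/-! ## §3 The tip-inside reading of the rooted one-step kernel = the straight tip-inside contour sum + the near block's axial potential -/

section TipInside

/-- NOT IN PRINT; OUR BOOKKEEPING.  **THE BLOCK AXIAL POTENTIAL OF A TIP-INSIDE TRUNCATION VANISHES ON EVERY OTHER BLOCK** (box root): for `B^{tip}_w κ u := 𝟙[blk L (u + e_κ) = w]·B κ u`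
and `y ≠ w`, `LamAt ρ B^{tip}_w L y = 0` — both endpoints of every bond of the axial contours from the root of the block `y` to its points lie in the block `y` (leaf-01's
`bonds_axial` ⨾ `blk_eq_of_hull_block`), so every letter carries the factor `𝟙[y = w] = 0`. -/
theorem LamAt_tipInside_of_ne {L : ℕ} {r : Fin (d + 1) → ℕ} (hr : r ∈ box (d + 1) L) (B : Form1 (d + 1) ℝ) (w : Site (d + 1))
    {y : Site (d + 1)} (hy : y ≠ w) :
    LamAt (toSite r) (fun κ u => (if blk L (u + unitVec κ) = w then (1 : ℝ) else 0) * B κ u) L y = 0 := by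
  unfold AveragingContoursRooted.LamAt
  refine Finset.sum_eq_zero fun b hb => List.sum_eq_zero fun a ha => ?_
  obtain ⟨κ', x', -, h2, h3⟩ := bonds_axial _ _ _ a ha
  have e2 : blk L (x' + unitVec κ') = y := by
    have h := blk_eq_of_hull_block y hr hb 0 (x' := x' + unitVec κ') (by simpa using h2)
    rwa [sub_zero] at h
  have h0 : (if blk L (x' + unitVec κ') = w then (1 : ℝ) else 0) * B κ' x' = 0 := by rw [e2, if_neg hy, zero_mul]
  rcases h3 with e | e
  · rw [e]; exact h0
  · rw [e, neg_eq_zero]; exact h0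

/-- NOT IN PRINT; OUR BOOKKEEPING.  **ON ITS OWN BLOCK THE TIP-INSIDE TRUNCATION IS INVISIBLE TO THE BLOCK AXIAL POTENTIAL**: `LamAt ρ B^{tip}_w L w = LamAt ρ B L w` (the
difference form `(1 − 𝟙[tip ∈ B(w)])·B` vanishes on every bond of the axial contours inside the block `w`; `axial_sum_sub`). -/
theorem LamAt_tipInside_self {L : ℕ} {r : Fin (d + 1) → ℕ} (hr : r ∈ box (d + 1) L) (B : Form1 (d + 1) ℝ) (w : Site (d + 1)) :
    LamAt (toSite r) (fun κ u => (if blk L (u + unitVec κ) = w then (1 : ℝ) else 0) * B κ u) L w = LamAt (toSite r) B L w := by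
  rw [← sub_eq_zero]
  unfold AveragingContoursRooted.LamAt
  rw [← Finset.sum_sub_distrib]
  refine Finset.sum_eq_zero fun b hb => ?_
  rw [← axial_sum_sub]
  refine List.sum_eq_zero fun a ha => ?_
  obtain ⟨κ', x', -, h2, h3⟩ := bonds_axial _ _ _ a ha
  have e2 : blk L (x' + unitVec κ') = w := by
    have h := blk_eq_of_hull_block w hr hb 0 (x' := x' + unitVec κ') (by simpa using h2)
    rwa [sub_zero] at h
  have h0 : ((fun κ u => (if blk L (u + unitVec κ) = w then (1 : ℝ) else 0) * B κ u) - B) κ' x' = 0 := by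
    simp only [Pi.sub_apply, e2, if_true, one_mul, sub_self]
  rcases h3 with e | e
  · rw [e, h0]
  · rw [e, h0, neg_zero]

/-- NOT IN PRINT; OUR BOOKKEEPING.  **THE BLOCK AXIAL POTENTIAL OF A COMB-FREE FORM VANISHES** (in-block root, `1 ≤ L`): if `B κ u = 0` on every comb bond `(κ, u)` of the
rooted comb (an2's `IsCombBondAt ρ L κ u`) then `LamAt ρ B L y = 0` for every block `y` — every bond of the axial contours from the root is a comb bond (an2's
`isCombBondAt_of_mem_axial`); e.g. the field rows of every `Π_bm`-co-dressed kernel (§4 `colH_coDressKBmAt_eq_zero_of_isCombBond`). -/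
theorem LamAt_eq_zero_of_combFree {L : ℕ} (hL : 1 ≤ L) {r : Fin (d + 1) → ℕ} (hr : r ∈ box (d + 1) L) {B : Form1 (d + 1) ℝ}
    (hB : ∀ κ u, IsCombBondAt (toSite r) L κ u → B κ u = 0) (y : Site (d + 1)) : LamAt (toSite r) B L y = 0 := by
  unfold AveragingContoursRooted.LamAt
  refine Finset.sum_eq_zero fun b hb => List.sum_eq_zero fun a ha => ?_
  obtain ⟨κ, z', e, hcomb⟩ := isCombBondAt_of_mem_axial hL hr hb y ha
  rcases e with e | e
  · rw [e, hB κ z' hcomb]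
  · rw [e, hB κ z' hcomb, neg_zero]

/-- NOT IN PRINT; OUR BOOKKEEPING.  **THE TIP-INSIDE READING OF THE ROOTED ONE-STEP KERNEL** (box root `ρ = toSite r`, `1 ≤ L`, coarse bond `(μ, w)`, EVERY real 1-form `B`):
`Σ'_u Σ_κ q¹,ρ_{(μ,w)}(κ,u)·𝟙[blk L (u + e_κ) = w]·B κ u = (L^{d+1})⁻¹·(contourSum L B^{tip}_w μ w + LamAt ρ B L w)` — my g48 `tsum_sum_linKerAt_mul` (the `q¹`-pairing of a
form is its rooted average), an1's `linAvgAt = contourSum − dz LamAt`, and the two lemmas above.  READING: `contourSum L B^{tip}_w μ w = Σ_{b ∈ box} Σ_{s ≤ L−2−b_μ} B μ (L·w + b + s·e_μ)`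
is the «END-INSIDE» partial straight contour operator (weight `i + 1` on the `μ`-bonds of the block `w` at offset `i ≤ L − 2`, the crossing bonds excluded) — leaf-06 g49's `Qei`;
the axial term is the block-`w` comb reading of `B`, absent for comb-free `B` (`LamAt_eq_zero_of_combFree`). -/
theorem tsum_sum_linKerAt_mul_tipInside {L : ℕ} {r : Fin (d + 1) → ℕ} (hr : r ∈ box (d + 1) L) (B : Form1 (d + 1) ℝ)
    (μ : Fin (d + 1)) (w : Site (d + 1)) :
    ∑' u, ∑ κ, linKerAt (toSite r) L μ w (κ, u) * ((if blk L (u + unitVec κ) = w then (1 : ℝ) else 0) * B κ u)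
      = ((L : ℝ) ^ (d + 1))⁻¹
          * (contourSum L (fun κ u => (if blk L (u + unitVec κ) = w then (1 : ℝ) else 0) * B κ u) μ w + LamAt (toSite r) B L w) := by
  rw [tsum_sum_linKerAt_mul hr (fun κ u => (if blk L (u + unitVec κ) = w then (1 : ℝ) else 0) * B κ u) μ w,
    linAvgAt_eq_contourSum_sub_dz, dz, LamAt_tipInside_of_ne hr B w (add_unitVec_ne w μ), LamAt_tipInside_self hr B w]
  ring

/-- NOT IN PRINT; OUR BOOKKEEPING.  The same in the «directions outside» order of §2: `Σ_κ Σ'_u 𝟙[blk L (u + e_κ) = w]·B κ u·q¹,ρ_{(μ,w)}(κ,u) = (L^{d+1})⁻¹·(contourSum L B^{tip}_w μ w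
+ LamAt ρ B L w)` (each `κ`-slice is finitely supported in `u`: `linKerAt_eq_zero_of_not_mem`). -/
theorem sum_tsum_tipInside_mul_linKerAt {L : ℕ} {r : Fin (d + 1) → ℕ} (hr : r ∈ box (d + 1) L) (B : Form1 (d + 1) ℝ)
    (μ : Fin (d + 1)) (w : Site (d + 1)) :
    ∑ κ, ∑' u, (if blk L (u + unitVec κ) = w then (1 : ℝ) else 0) * B κ u * linKerAt (toSite r) L μ w (κ, u)
      = ((L : ℝ) ^ (d + 1))⁻¹
          * (contourSum L (fun κ u => (if blk L (u + unitVec κ) = w then (1 : ℝ) else 0) * B κ u) μ w + LamAt (toSite r) B L w) := by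
  rw [← tsum_sum_linKerAt_mul_tipInside hr B μ w]
  have hs : ∀ κ, Summable fun u => (if blk L (u + unitVec κ) = w then (1 : ℝ) else 0) * B κ u * linKerAt (toSite r) L μ w (κ, u) := fun κ =>
    LinearGaugeVH.summable_of_finsupp (nearBox L w) fun u hu => by rw [linKerAt_eq_zero_of_not_mem hr μ hu κ, mul_zero]
  rw [← Summable.tsum_finsetSum (fun κ _ => hs κ)]
  exact tsum_congr fun u => Finset.sum_congr rfl fun κ _ => by ring

/-- [folklore] **BRIDGE TO leaf-06 g49's END-INSIDE SUM `EI_L`** (written inline in `BlockWeightContourCommutation` ∕ `GaugeLegDefectsBlockConstant`): the straight contour sum of the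
tip-inside truncation IS the end-inside partial contour sum, `contourSum L B^{tip}_w μ w = Σ_{b ∈ box} Σ_{s < L} [b_μ + s + 1 < L]·B μ (L•w + b + s•e_μ)` (leaf-06 g47 `blk_contourPoint`). -/
theorem contourSum_tipInside_eq_endInside {L : ℕ} (hL : 1 ≤ L) (B : Form1 (d + 1) ℝ) (μ : Fin (d + 1)) (w : Site (d + 1)) :
    contourSum L (fun κ u => (if blk L (u + unitVec κ) = w then (1 : ℝ) else 0) * B κ u) μ w
      = ∑ b ∈ box (d + 1) L, ∑ s ∈ Finset.range L, (if b μ + s + 1 < L then B μ ((L : ℤ) • w + toSite b + (s : ℤ) • unitVec μ) else 0) := by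
  simp only [AffineAveraging.contourSum]
  refine Finset.sum_congr rfl fun b hb => Finset.sum_congr rfl fun s hs => ?_
  have hs' := Finset.mem_range.1 hs
  have hbμ : b μ < L := Finset.mem_range.1 (Fintype.mem_piFinset.1 hb μ)
  have e : (L : ℤ) • w + toSite b + (s : ℤ) • unitVec μ + unitVec μ = (L : ℤ) • w + toSite b + ((s + 1 : ℕ) : ℤ) • unitVec μ := by
    rw [Nat.cast_succ, add_smul, one_smul, add_assoc]
  rw [e, blk_contourPoint hL w hb μ (t := s + 1) (by omega)]
  by_cases h : b μ + s + 1 < L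
  · rw [if_neg (show ¬ (L ≤ b μ + (s + 1)) by omega), add_zero, if_pos rfl, one_mul, if_pos h]
  · rw [if_pos (show L ≤ b μ + (s + 1) by omega), if_neg (add_unitVec_ne w μ), zero_mul, if_neg h]

end TipInside

/-! ## §4 The V-law on the coarse multiplier leg `p = Lc•w`, in closed form -/

section Coarse

variable {Lc : ℕ} [NeZero Lc]

/-- NOT IN PRINT; OUR BOOKKEEPING.  **THE V-LAW, CLOSED FORM** (box root `ρ = toSite r`, `1 ≤ Lc`, ANY kernel `K`, every level `j`, all `cE cVH cΛ`, slot `(ν, y′)`, coarse multiplier bond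
`(μ, w)`, block-constant `Ψ = ψ ∘ blk Lc`; `H κ u := colH K Lc ν y′ κ u` the field rows of the `(ν,y′)`-column, `H^{tip}_w κ u := 𝟙[blk Lc (u + e_κ) = w]·H κ u`):
`Σ'_x Σ_κ₂ (dM K Lc S_j M1_j ν y′) (Lc•w) x (inr μ)(inl κ₂)·(dz Ψ)_κ₂(x) = −(cVH·wVH d Lc j)·(dz ψ)_μ(w)·(Lc^{d+1})⁻¹·(contourSum Lc H^{tip}_w μ w + LamAt ρ H Lc w)`
— «the border sector of the slot derivative against a block pure gauge = minus the face jump at the multiplier bond times the END-INSIDE partial contour reading of the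
`ℋ`-column (plus its block-`w` comb reading, absent for comb-dressed kernels)» — leaf-06 g49's «V = −n^{−2D}·⟨dψ ⊙ Qei H_0 h, C_0 n⟩» before the contraction with the
multiplier weights (ENGINE E31, `HOME/b2b-balaban-gan24-formalise-leaf-06/g49/E30-E31-CENSUS.md` (B); float64 there, a theorem here). -/
theorem tsum_dM_inr_inl_zsmul_mul_dz_blockPot (K : MKer (d + 1) (Fib d)) (hLc : 1 ≤ Lc) {r : Fin (d + 1) → ℕ} (hr : r ∈ box (d + 1) Lc)
    (cE cVH cΛ : ℝ) (j : ℕ) (ν : Fin (d + 1)) (y' w : Site (d + 1)) (μ : Fin (d + 1)) {Ψ : Site (d + 1) → ℝ} (ψ : Site (d + 1) → ℝ)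
    (hΨ : ∀ x, Ψ x = ψ (blk Lc x)) :
    ∑' x, ∑ κ₂, dM K Lc (SpureRecAt d Lc (toSite r) cE cVH cΛ j) (M1At d Lc (toSite r) cΛ j) ν y' ((Lc : ℤ) • w) x (Sum.inr μ) (Sum.inl κ₂) * dz Ψ κ₂ x
      = -(cVH * wVH d Lc j) * dz ψ μ w * (((Lc : ℝ) ^ (d + 1))⁻¹
          * (contourSum Lc (fun κ u => (if blk Lc (u + unitVec κ) = w then (1 : ℝ) else 0) * colH K Lc ν y' κ u) μ w
              + LamAt (toSite r) (colH K Lc ν y') Lc w)) := by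
  rw [tsum_dM_inr_inl_mul_dz_blockPot K hLc hr cE cVH cΛ j ν y' ((Lc : ℤ) • w) μ ψ hΨ, blk_zsmul hLc,
    ← sum_tsum_tipInside_mul_linKerAt hr (colH K Lc ν y') μ w]
  congr 1
  refine Finset.sum_congr rfl fun κ' _ => tsum_congr fun u' => ?_
  rw [linSymAt_inr_inl, off_zsmul Lc, if_pos rfl, blk_zsmul hLc]

/-- NOT IN PRINT; OUR BOOKKEEPING.  **THE V-LAW FOR A COMB-FREE COLUMN** (the case of every `Π_bm`-co-dressed kernel `G_j`): if the field rows of the `(ν,y′)`-column vanish on the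
rooted comb, the axial term drops and the border sector is EXACTLY minus the face jump times the end-inside partial contour reading:
`Σ'_x Σ_κ₂ (dM K Lc S_j M1_j ν y′) (Lc•w) x (inr μ)(inl κ₂)·(dz Ψ)_κ₂(x) = −(cVH·wVH d Lc j)·(dz ψ)_μ(w)·(Lc^{d+1})⁻¹·contourSum Lc H^{tip}_w μ w`. -/
theorem tsum_dM_inr_inl_zsmul_mul_dz_blockPot_of_combFree (K : MKer (d + 1) (Fib d)) (hLc : 1 ≤ Lc) {r : Fin (d + 1) → ℕ}
    (hr : r ∈ box (d + 1) Lc) (cE cVH cΛ : ℝ) (j : ℕ) (ν : Fin (d + 1)) (y' w : Site (d + 1)) (μ : Fin (d + 1)) {Ψ : Site (d + 1) → ℝ}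
    (ψ : Site (d + 1) → ℝ) (hΨ : ∀ x, Ψ x = ψ (blk Lc x)) (hcomb : ∀ κ u, IsCombBondAt (toSite r) Lc κ u → colH K Lc ν y' κ u = 0) :
    ∑' x, ∑ κ₂, dM K Lc (SpureRecAt d Lc (toSite r) cE cVH cΛ j) (M1At d Lc (toSite r) cΛ j) ν y' ((Lc : ℤ) • w) x (Sum.inr μ) (Sum.inl κ₂) * dz Ψ κ₂ x
      = -(cVH * wVH d Lc j) * dz ψ μ w * (((Lc : ℝ) ^ (d + 1))⁻¹
          * contourSum Lc (fun κ u => (if blk Lc (u + unitVec κ) = w then (1 : ℝ) else 0) * colH K Lc ν y' κ u) μ w) := by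
  rw [tsum_dM_inr_inl_zsmul_mul_dz_blockPot K hLc hr cE cVH cΛ j ν y' w μ ψ hΨ, LamAt_eq_zero_of_combFree hLc hr hcomb w, add_zero]

/-- [folklore] **THE FIELD ROWS OF A `Π_bm`-CO-DRESSED KERNEL VANISH ON THE ROOTED COMB**: `colH (coDressKBmAt ρ N K) N ν y′ κ u = 0` for every comb bond `(κ, u)` (an2's
`colH_coDressKBmAt` — the column is a windowed `Π_bm`-image — and `pmBm_eq_zero_of_isCombBond`). -/
theorem colH_coDressKBmAt_eq_zero_of_isCombBond {N : ℕ} (ρ : Fin (d + 1) → ℤ) (K : MKer (d + 1) (Fib d)) (ν : Fin (d + 1)) (y' : Site (d + 1))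
    {κ : Fin (d + 1)} {u : Site (d + 1)} (hc : IsCombBondAt ρ N κ u) : colH (coDressKBmAt ρ N K) N ν y' κ u = 0 := by
  rw [colH_coDressKBmAt]
  refine Finset.sum_eq_zero fun v _ => Finset.sum_eq_zero fun κ₁ _ => ?_
  rw [pmBm_eq_zero_of_isCombBond hc, zero_mul]

/-- NOT IN PRINT; OUR BOOKKEEPING.  **THE V-LAW FOR THE CO-DRESSED KERNELS `G = coDressKBmAt ρ Lc K` (ANY `K`; in particular road-P2's `G_j = coDressKBmAt ρ Lc (KInvStep Lc j)`)**:
`Σ'_x Σ_κ₂ (dM G Lc S_j M1_j ν y′) (Lc•w) x (inr μ)(inl κ₂)·(dz Ψ)_κ₂(x) = −(cVH·wVH d Lc j)·(dz ψ)_μ(w)·(Lc^{d+1})⁻¹·contourSum Lc (colH G Lc ν y′)^{tip}_w μ w` — NO axial term. -/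
theorem tsum_dM_coDressKBmAt_inr_inl_zsmul_mul_dz_blockPot (K : MKer (d + 1) (Fib d)) (hLc : 1 ≤ Lc) {r : Fin (d + 1) → ℕ}
    (hr : r ∈ box (d + 1) Lc) (cE cVH cΛ : ℝ) (j : ℕ) (ν : Fin (d + 1)) (y' w : Site (d + 1)) (μ : Fin (d + 1)) {Ψ : Site (d + 1) → ℝ}
    (ψ : Site (d + 1) → ℝ) (hΨ : ∀ x, Ψ x = ψ (blk Lc x)) :
    ∑' x, ∑ κ₂, dM (coDressKBmAt (toSite r) Lc K) Lc (SpureRecAt d Lc (toSite r) cE cVH cΛ j) (M1At d Lc (toSite r) cΛ j) ν y'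
        ((Lc : ℤ) • w) x (Sum.inr μ) (Sum.inl κ₂) * dz Ψ κ₂ x
      = -(cVH * wVH d Lc j) * dz ψ μ w * (((Lc : ℝ) ^ (d + 1))⁻¹
          * contourSum Lc (fun κ u => (if blk Lc (u + unitVec κ) = w then (1 : ℝ) else 0) * colH (coDressKBmAt (toSite r) Lc K) Lc ν y' κ u) μ w) :=
  tsum_dM_inr_inl_zsmul_mul_dz_blockPot_of_combFree _ hLc hr cE cVH cΛ j ν y' w μ ψ hΨ
    fun _ _ hc => colH_coDressKBmAt_eq_zero_of_isCombBond (toSite r) K ν y' hc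

end Coarse

end Summit.QuantumFields.BalabanUV.Beta.GAN24.BorderGaugeLegBlockPotential

end
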